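import Summits.ValiantsHypothesis.ValiantsHypothesis.Theorems.BarrierLeverAnchoredDoorHitsLowerPairsXElimRecursion

/-!
# Support item `AnchoredDoorHitsLowerPairs` (stmt-ValiantsHypothesis-22510), line `anchored-peeling`:
# THE X-ELIMINATION LEAVES — the counting criterion `|U| ≥ ⌈|W|/2⌉` gives a good leaf (part 5 of the x-elimination recursion for Conjecture Z)

Helper file (`--supports stmt-ValiantsHypothesis-22510`; cell valiant-natproofs, rung V4, 𝒟-side door (c); registered line
`Cruxes/AnchoredDoorHitsLowerPairs/Lines/anchored_peeling.lean` v26; node `Stmt.stub_conjZ` (p695484); prover seat val-np-p1 gen 26; memo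
HOME/val-np-p1/g26/MEMO-conjZ-node-valnp1-g26.md §4). Closes NO item. Sequel of `…XElimRecursion` (certificates `XElim.XCert`, leaves `XElim.LeafGood`).

**`leafGood_of_card`.** The 1 × 1 labelled problem (row `U`; column `(L, W)`) has a nonzero entry for some parameters as soon as
`W ≠ ∅ → ⌈|W|/2⌉ ≤ |U|` and `W = ∅ → L = ∅ → U = ∅` — the purely combinatorial leaf rule of the certificate search (lab/xcert2.py). Proof: for `W ≠ ∅`
choose an anchor set `J₀ ∈ jSet W` whose roots are DISTINCT SINGLETONS of `U` (`exists_jSet_singleton_roots`, induction on `W` through the blocks),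
weights = indicator of `J₀`, all `x`-tails `1`, no labels' tails: the entry is `|J₀|^{|U ∖ roots|} ≠ 0`; for `W = ∅` the entry is `1` (one label with all tails
`1`, or no label and `U = ∅`). Hence the derived certificate constructor `XCert.leaf_of_card`, which makes the certificates of `…XElimRecursion` purely
combinatorial objects.

WHAT THIS IS NOT: nothing on which pairs have certificates; nothing on crux stmt-ValiantsHypothesis-14610 or on `VP` versus `VNP`.
-/

set_option linter.dupNamespace false

namespace Summit.ValiantsHypothesis.ValiantsHypothesis.Theorems.BarrierLever.AnchoredPeeling

open Finset MvPolynomial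
open Summit.ValiantsHypothesis.ValiantsHypothesis.Theorems.BarrierLever.BrickCalculus (pexpo pexpo_def pexpo_le_iff pexpo_sub
  pexpo_apply_castAdd pexpo_apply_natAdd)

noncomputable section

namespace XElim

variable {h : ℕ}

/-! ## 1. Anchor sets with distinct singleton roots -/

/-- The only anchor set of the empty column is `∅`. -/
theorem mem_jSet_empty {J : Finset (Anchor h)} : J ∈ jSet (∅ : Finset (Fin h)) ↔ J = ∅ := by
  classical
  constructor
  · intro hJ
    obtain ⟨hsub, ⟨_, hfoot⟩, _⟩ := mem_jSet.mp hJ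
    refine Finset.eq_empty_of_forall_notMem (fun α hα => ?_)
    have hB : 1 ≤ α.2.card := (mem_anchors_two.mp (hsub hα)).2.2.1
    obtain ⟨x, hx⟩ := Finset.card_pos.mp (show 0 < α.2.card by omega)
    have : x ∈ AnchorSets.yFoot J := by rw [AnchorSets.yFoot, Finset.mem_biUnion]; exact ⟨α, hα, hx⟩
    rw [hfoot] at this
    exact Finset.notMem_empty x this
  · rintro rfl
    refine mem_jSet.mpr ⟨Finset.empty_subset _, ⟨?_, ?_⟩, ?_⟩
    · rw [Finset.coe_empty]; exact Set.pairwiseDisjoint_empty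
    · rw [AnchorSets.yFoot, Finset.biUnion_empty]
    · rw [P2.nPairs, Finset.filter_empty, Finset.card_empty, Finset.card_empty]

/-- A nonempty column has a block. -/
theorem exists_block {W : Finset (Fin h)} (hW : W.Nonempty) : ∃ B, B ∈ blocks W := by
  classical
  by_cases h2 : 2 ≤ W.card
  · obtain ⟨B, hBW, hB⟩ := Finset.exists_subset_card_eq h2
    exact ⟨B, mem_blocks.mpr ⟨hBW, Or.inl hB⟩⟩
  · have h1 : W.card = 1 := by have := Finset.card_pos.mpr hW; omega
    exact ⟨W, mem_blocks.mpr ⟨subset_rfl, Or.inr ⟨h1, by rw [h1]; omega⟩⟩⟩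

/-- **An anchor set of `W` with distinct singleton roots inside `U` exists as soon as `⌈|W|/2⌉ ≤ |U|`.** -/
theorem exists_jSet_singleton_roots : ∀ (n : ℕ) (W U : Finset (Fin h)), W.card ≤ n → (W.card + 1) / 2 ≤ U.card →
    ∃ J₀ ∈ jSet W, (∀ α ∈ J₀, ∃ x ∈ U, α.1 = {x}) ∧ (↑J₀ : Set (Anchor h)).PairwiseDisjoint Prod.fst ∧ J₀.card = (W.card + 1) / 2 := by
  classical
  intro n
  induction n with
  | zero =>
    intro W U hW _
    have hW0 : W = ∅ := Finset.card_eq_zero.mp (by omega)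
    subst hW0
    exact ⟨∅, mem_jSet_empty.mpr rfl, fun α hα => absurd hα (Finset.notMem_empty α), by rw [Finset.coe_empty]; exact Set.pairwiseDisjoint_empty,
      by rw [Finset.card_empty, Finset.card_empty]⟩
  | succ n ih =>
    intro W U hWn hU
    by_cases hW : W = ∅
    · subst hW
      exact ⟨∅, mem_jSet_empty.mpr rfl, fun α hα => absurd hα (Finset.notMem_empty α), by rw [Finset.coe_empty]; exact Set.pairwiseDisjoint_empty,
        by rw [Finset.card_empty, Finset.card_empty]⟩
    · obtain ⟨B, hB⟩ := exists_block (Finset.nonempty_iff_ne_empty.mpr hW)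
      obtain ⟨hBW, hBc⟩ := mem_blocks.mp hB
      have hUpos : 0 < U.card := by
        have : 1 ≤ W.card := Finset.card_pos.mpr (Finset.nonempty_iff_ne_empty.mpr hW); omega
      obtain ⟨x, hx⟩ := Finset.card_pos.mp hUpos
      have hcardW' : (W \ B).card = W.card - B.card := Finset.card_sdiff_of_subset hBW
      have hBle : B.card ≤ W.card := Finset.card_le_card hBW
      have hW'n : (W \ B).card ≤ n := by rw [hcardW']; rcases hBc with h2 | ⟨h1, _⟩ <;> omega
      have hU' : ((W \ B).card + 1) / 2 ≤ (U.erase x).card := by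
        rw [hcardW', Finset.card_erase_of_mem hx]; rcases hBc with h2 | ⟨h1, hodd⟩ <;> omega
      obtain ⟨J', hJ', hroots, hdis, hcard⟩ := ih (W \ B) (U.erase x) hW'n hU'
      obtain ⟨hins, hnot⟩ := insert_mem_jSet (a := x) hB hJ'
      refine ⟨insert (({x} : Finset (Fin h)), B) J', hins, ?_, ?_, ?_⟩
      · intro α hα
        rcases Finset.mem_insert.mp hα with rfl | hα'
        · exact ⟨x, hx, rfl⟩
        · obtain ⟨y, hy, hyα⟩ := hroots α hα'
          exact ⟨y, Finset.mem_of_mem_erase hy, hyα⟩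
      · rw [Finset.coe_insert]
        refine Set.PairwiseDisjoint.insert hdis (fun β hβ _ => ?_)
        obtain ⟨y, hy, hyβ⟩ := hroots β hβ
        simp only [hyβ, Finset.disjoint_singleton_left, Finset.mem_singleton]
        exact fun heq => Finset.ne_of_mem_erase hy heq.symm
      · rw [Finset.card_insert_of_notMem hnot, hcard, hcardW']
        rcases hBc with h2 | ⟨h1, hodd⟩ <;> omega

/-- An anchor set of `W` contained in another one equals it. -/
theorem eq_of_subset_of_mem_jSet {W : Finset (Fin h)} {J J₀ : Finset (Anchor h)} (hJ : J ∈ jSet W) (hJ₀ : J₀ ∈ jSet W) (hsub : J ⊆ J₀) : J = J₀ := by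
  classical
  refine Finset.Subset.antisymm hsub (fun α hα => ?_)
  by_contra hαJ
  obtain ⟨hsub₀, ⟨hdis₀, hfoot₀⟩, _⟩ := mem_jSet.mp hJ₀
  obtain ⟨_, ⟨_, hfoot⟩, _⟩ := mem_jSet.mp hJ
  have hB : 1 ≤ α.2.card := (mem_anchors_two.mp (hsub₀ hα)).2.2.1
  obtain ⟨x, hx⟩ := Finset.card_pos.mp (show 0 < α.2.card by omega)
  have hxW : x ∈ W := by rw [← hfoot₀, AnchorSets.yFoot, Finset.mem_biUnion]; exact ⟨α, hα, hx⟩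
  rw [← hfoot, AnchorSets.yFoot, Finset.mem_biUnion] at hxW
  obtain ⟨β, hβ, hxβ⟩ := hxW
  have hne : β ≠ α := fun heq => hαJ (heq ▸ hβ)
  exact Finset.disjoint_left.mp (hdis₀ (Finset.mem_coe.mpr (hsub hβ)) (Finset.mem_coe.mpr hα) hne) hxβ hx

/-! ## 2. Readings of label exponentials -/

/-- **The reading of a label exponential:** `[x^U] E_ℓ = ∏_{b ∈ U} Ψ ℓ b`. -/
theorem coeff_labE (Ψ : Anchor h → Fin h → ℂ) (ℓ : Anchor h) (U : Finset (Fin h)) :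
    coeff (pexpo U ∅) (labE Ψ ℓ) = ∏ b ∈ U, Ψ ℓ b := by
  classical
  rw [labE, show (∏ b : Fin h, (1 + C (Ψ ℓ b) * X (Fin.castAdd h b)) : MvPolynomial (Fin (h + h)) ℂ) =
    ∏ b ∈ (Finset.univ : Finset (Fin h)), (1 + C (Ψ ℓ b) * X (Fin.castAdd h b)) from rfl,
    ProductRule.prod_one_add_C_mul_X_fun, coeff_sum]
  rw [Finset.sum_eq_single_of_mem U (Finset.mem_powerset.mpr (Finset.subset_univ U))]
  · rw [show (∑ d ∈ U, Finsupp.single (Fin.castAdd h d) 1) = pexpo U ∅ by rw [pexpo_def, Finset.sum_empty, add_zero], coeff_monomial, if_pos rfl]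
  · intro D _ hne
    rw [show (∑ d ∈ D, Finsupp.single (Fin.castAdd h d) 1) = pexpo D ∅ by rw [pexpo_def, Finset.sum_empty, add_zero], coeff_monomial,
      if_neg (fun heq => hne (DistinctAnchors.pexpo_inj heq).1)]

/-- A label exponential with zero tails is `1`. -/
theorem labE_eq_one_of_zero {Ψ : Anchor h → Fin h → ℂ} {ℓ : Anchor h} (hΨ : ∀ b, Ψ ℓ b = 0) : labE Ψ ℓ = 1 := by
  rw [labE]
  exact Finset.prod_eq_one (fun b _ => by rw [hΨ b, C_0, zero_mul, add_zero])

/-! ## 3. Good leaves from the counting criterion -/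

/-- The maximum-matching element of the empty column is `1`. -/
theorem tW_empty (Θ : Anchor h → ℂ) (Φ : Anchor h → Fin h → ℂ) : tW Θ Φ (∅ : Finset (Fin h)) = 1 := by
  classical
  have hset : jSet (∅ : Finset (Fin h)) = {∅} := by
    ext J; rw [mem_jSet_empty, Finset.mem_singleton]
  rw [tW, hset, Finset.sum_singleton, Finset.prod_empty, Finset.prod_empty, C_1, mul_one]

/-- **Leaf, empty column.** `W = ∅`, and `U = ∅` unless a label is present: a good leaf. -/
theorem leafGood_empty (U : Finset (Fin h)) (L : Finset (Anchor h)) (h0 : L = ∅ → U = ∅) : LeafGood U (L, (∅ : Finset (Fin h))) := by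
  classical
  by_cases hL : L = ∅
  · subst hL
    have hU := h0 rfl
    subst hU
    refine ⟨fun _ => 0, fun _ _ => 0, fun _ _ => 0, ?_⟩
    rw [entry, colE, show ((∅ : Finset (Anchor h)), (∅ : Finset (Fin h))).1 = ∅ from rfl, Finset.prod_empty, one_mul,
      show ((∅ : Finset (Anchor h)), (∅ : Finset (Fin h))).2 = ∅ from rfl, tW_empty,
      show pexpo (∅ : Finset (Fin h)) ∅ = 0 by rw [pexpo_def, Finset.sum_empty, Finset.sum_empty, add_zero], MvPolynomial.coeff_zero_one]
    exact one_ne_zero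
  · obtain ⟨ℓ₀, hℓ₀⟩ := Finset.nonempty_iff_ne_empty.mpr hL
    refine ⟨fun _ => 0, fun _ _ => 0, fun ℓ _ => if ℓ = ℓ₀ then 1 else 0, ?_⟩
    rw [entry, colE, show (L, (∅ : Finset (Fin h))).2 = ∅ from rfl, tW_empty, mul_one, show (L, (∅ : Finset (Fin h))).1 = L from rfl,
      ← Finset.mul_prod_erase L _ hℓ₀]
    have hrest : ∏ ℓ ∈ L.erase ℓ₀, labE (fun ℓ (_ : Fin h) => if ℓ = ℓ₀ then (1 : ℂ) else 0) ℓ = 1 :=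
      Finset.prod_eq_one (fun ℓ hℓ => labE_eq_one_of_zero (fun b => by rw [if_neg (Finset.ne_of_mem_erase hℓ)]))
    rw [hrest, mul_one, coeff_labE]
    simp only [if_true, Finset.prod_const_one]
    exact one_ne_zero

/-- **Leaf, nonempty column.** `⌈|W|/2⌉ ≤ |U|`: a good leaf (indicator weights of an anchor set with distinct singleton roots in `U`, unit tails). -/
theorem leafGood_of_card_le {U W : Finset (Fin h)} (hW : W.Nonempty) (hle : (W.card + 1) / 2 ≤ U.card) (L : Finset (Anchor h)) :
    LeafGood U (L, W) := by
  classical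
  obtain ⟨J₀, hJ₀, hroots, hdis, hcard⟩ := exists_jSet_singleton_roots W.card W U le_rfl hle
  have hJ₀ne : J₀.Nonempty := Finset.card_pos.mp (by rw [hcard]; have := Finset.card_pos.mpr hW; omega)
  refine ⟨fun α => if α ∈ J₀ then 1 else 0, fun _ _ => 1, fun _ _ => 0, ?_⟩
  have hlab : ∏ ℓ ∈ (L, W).1, labE (fun (_ : Anchor h) (_ : Fin h) => (0 : ℂ)) ℓ = 1 :=
    Finset.prod_eq_one (fun ℓ _ => labE_eq_one_of_zero (fun _ => rfl))
  rw [entry, colE, hlab, one_mul, show (L, W).2 = W from rfl, tW, coeff_sum]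
  -- only `J₀` survives
  rw [Finset.sum_eq_single_of_mem J₀ hJ₀]
  · rw [coeff_C_mul, coeff_prod_xPartE, Finset.prod_congr rfl (fun α hα => if_pos hα), Finset.prod_const_one, one_mul, P2.xcE]
    have hfoot : AnchorSets.xFoot J₀ ⊆ U := by
      intro y hy
      rw [AnchorSets.xFoot, Finset.mem_biUnion] at hy
      obtain ⟨α, hα, hyα⟩ := hy
      obtain ⟨x, hx, hxα⟩ := hroots α hα
      rw [hxα, Finset.mem_singleton] at hyα
      rw [hyα]; exact hx
    rw [if_pos ⟨hdis, hfoot⟩]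
    refine Finset.prod_ne_zero_iff.mpr (fun b _ => ?_)
    rw [Finset.sum_const, nsmul_eq_mul, mul_one, Nat.cast_ne_zero]
    exact Finset.card_ne_zero.mpr hJ₀ne
  · intro J hJ hne
    rw [coeff_C_mul]
    have hzero : (∏ α ∈ J, (if α ∈ J₀ then (1 : ℂ) else 0)) = 0 := by
      have hnsub : ¬ J ⊆ J₀ := fun hsub => hne (eq_of_subset_of_mem_jSet hJ hJ₀ hsub)
      obtain ⟨α, hαJ, hα⟩ := Finset.not_subset.mp hnsub
      exact Finset.prod_eq_zero hαJ (if_neg hα)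
    rw [hzero, zero_mul]

/-- **THE COMBINATORIAL LEAF RULE ⟹ a good leaf.** -/
theorem leafGood_of_card (U W : Finset (Fin h)) (L : Finset (Anchor h)) (hle : W.Nonempty → (W.card + 1) / 2 ≤ U.card)
    (h0 : W = ∅ → L = ∅ → U = ∅) : LeafGood U (L, W) := by
  by_cases hW : W = ∅
  · subst hW; exact leafGood_empty U L (h0 rfl)
  · exact leafGood_of_card_le (Finset.nonempty_iff_ne_empty.mpr hW) (hle (Finset.nonempty_iff_ne_empty.mpr hW)) L

/-- **Derived certificate constructor: a leaf from the counting criterion.** -/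
theorem XCert.leaf_of_card (U W : Finset (Fin h)) (L : Finset (Anchor h)) (hle : W.Nonempty → (W.card + 1) / 2 ≤ U.card)
    (h0 : W = ∅ → L = ∅ → U = ∅) : XCert ({U} : Finset (Finset (Fin h))) ({(L, W)} : Finset (LCol h)) :=
  XCert.leaf (leafGood_of_card U W L hle h0)

end XElim

end

end Summit.ValiantsHypothesis.ValiantsHypothesis.Theorems.BarrierLever.AnchoredPeeling
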